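import Summits.QuantumFields.BalabanUV.T4Continuum.Support.NE3CovariantWeitzenbock
import Summits.QuantumFields.BalabanUV.T4Continuum.Support.NE3TangentCovariantTower
import HarnessLib

/-!
# T⁴ programme, node NE3 — LANDAU ORTHOGONALITY OF THE LINEARISED GAUGE ORBIT:
# `Σ_x Σ_μ ⟨Y(x,μ), gaugeDir W λ (x,μ)⟩ = Σ_x ⟨covDiv W Y (x), λ(x)⟩`, hence the Landau representative minimises the ℓ²-norm in its orbit

NE3 formalisation swarm `b2b-balaban-t4-ne3-formalise-*`, LEAF PROVER 04 (gen 4), sub-row **E-MLw-w4-S** file 3∕3 (SUPPLEMENT; INTENT in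
HOME/CLAIMS.log 2026-08-20 ≈14:38Z) under the (w4) CORE of `t4/formal/NE3/LEAVES.md` row E-MLw-w4.  Companion of
`NE3TangentCovariantTower.tangentIter_add_gaugeDir_iff`∕`dirIter_add_gaugeDir` (which say how the linearised gauge orbit `Y + gaugeDir W μ`
meets the tangent space `T(W)`): here is what the LANDAU clause `covDiv W Y = 0` does to that orbit.

CONTENT (all [folklore]; 0 sorry; 0 def; exact finite-dimensional linear algebra, no smallness, no curvature):
* `hsR_zero_right`∕`hsR_zero_left`∕`hsR_neg_right`, `nhsNormSq_add` (polarisation), `eq_zero_of_nhsNormSq_eq_zero`;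
* `hsR_gaugeDir` — pointwise: `⟨Y(x,μ), gaugeDir W λ (x,μ)⟩ = ⟨Ad_{W(x,μ)} Y(x,μ), λ(x)⟩ − ⟨Y(x,μ), λ(x+e_μ)⟩` (`hsR_Ad_left`);
* **`sum_hsR_gaugeDir`** — for unitary `W` and `P`-periodic `Y`, `λ` (`P ≥ 1`):
  `Σ_{x∈periodBox P} Σ_μ hsR (Y x μ) (gaugeDir W λ x μ) = Σ_{x∈periodBox P} hsR (covDiv W Y x) (λ x)` — the linearised gauge directions
  (`BlockAveragePushDirGauge.gaugeDir`, the tree's convention of `pushDir_gaugeDir_eq_gaugeDir_cavg`) are EXACTLY the `hsR`-orthogonal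
  complement of the kernel of the covariant backward divergence `NE3CovariantWeitzenbock.covDiv` (same end-framed convention as
  `AveragingDeficitCovGrad.covFd`); one periodic shift (`sum_periodBox_shift`), nothing else;
* **`sum_nhsNormSq_add_gaugeDir`** — `covDiv W Y = 0` on the period box ⇒
  `Σ nhsNormSq (Y + gaugeDir W λ) = Σ nhsNormSq Y + Σ nhsNormSq (gaugeDir W λ)`;
* **`sum_nhsNormSq_le_of_covDiv_eq_zero`** — THE LANDAU REPRESENTATIVE MINIMISES THE ℓ²-NORM IN ITS LINEARISED GAUGE ORBIT:
  `Σ_{x,μ} nhsNormSq (Y x μ) ≤ Σ_{x,μ} nhsNormSq (Y x μ + gaugeDir W λ x μ)` for every `P`-periodic generator `λ`;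
* **`covDiv_eq_zero_of_orthogonal`** — conversely, a periodic `Y` orthogonal to every periodic gauge direction is covariantly
  divergence-free on the period box (test with `λ = covDiv W Y`, periodic by `covDiv_add_period`);
* §3 the orbit and the k-fold average (corollary of `NE3TangentCovariantTower`): `gaugeDir_skew`, and **`QbarIter_gaugeDir`** —
  `QbarIter L (j+1) W (gaugeDir W μ) = gaugeDir U (μ ∘ L^{j+1}•) − gaugeDir U (framePotW L (j+1) W (gaugeDir W μ))`, `U = cavgIter L (j+1) W`:
  the k-fold covariant double-bar average of a gauge direction is again a coarse gauge direction (generator = the rescaled generator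
  minus the accumulated frames of the gauge direction).

WHY (honest).  For the Poincaré half w4-P of the (w4) core («`Σ|Y|² ≤ C·L^{2k}·Σ|covFd W Y|²` on `T(W) ∩ Landau`», RESERVED in the
typer's table, NOT claimed here) this reduces the Landau-gauge `Σ|Y|²` to `Σ|Y′|²` for ANY orbit representative `Y′ = Y + gaugeDir W μ`
— the freedom one uses to remove coarse gauge modes from the generator of the structure theorem `NE3TangentCovariantTower`.  Nothing
about Bałaban's minimisers, (P_W), (ML_w), T-E_w or NE3 is asserted; NE3 NOT proved; spine 0∕9; finite T⁴ rung (B)+1 — NOT infinite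
volume, NOT mass gap, NOT BetaPertH, NOT Clay.  ABSOLUTE RULE kept (context: [Balaban1985Variational] (83) p. 290, the Landau-gauge
restriction of the fluctuation field).  PLACEMENT: `Summits/QuantumFields/BalabanUV/`.
-/

set_option autoImplicit false

open scoped BigOperators Matrix.Norms.L2Operator
open Finset

namespace Summit.QuantumFields.BalabanUV.T4Continuum.NE3LandauOrbit

open Literature.MathematicalPhysics.QuantumFieldTheory.Balaban1983to89
open B7Prop1Explicit B7Prop2Explicit MatrixNorms
open T4AveragingDeficitWall (IsUnitaryCfg IsSkewDir SmallField Ad)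
open T4AveragingDeficitWallBoundary (periodBox sum_periodBox_shift IsPeriodicCfg)
open AveragingDeficitPeriodicCounting (IsPeriodicDir)
open AveragingDeficitTransport (Ad_mem_skewAdjoint)
open AveragingDeficitMultiLevelPrep (cavgIter tower LevelSmall)
open BlockAveragePushDirGauge (gaugeDir isPeriodicDir_gaugeDir)
open NE3TangentCovariantTower (QbarIter framePotW dirIter_eq_QbarIter_add_gaugeDir dirIter_gaugeDir)
open NE3CovariantCalculus (hsR hsR_Ad_left hsR_add_right hsR_sub_right hsR_sub_left hsR_sum_left hsR_self hsR_comm nhsNormSq_sub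
  nhsNormSq_neg)
open NE3CovariantWeitzenbock (covDiv)

noncomputable section

variable {d : ℕ} {n : Type*} [Fintype n] [DecidableEq n]

/-! ## §1 Small algebra of the real Hilbert–Schmidt form -/

/-- `hsR X 0 = 0`. [folklore] -/
theorem hsR_zero_right (X : (Matrix n n ℂ)) : hsR X 0 = 0 := by
  have h := hsR_add_right X 0 0
  rw [add_zero] at h
  linarith

/-- `hsR 0 Y = 0`. [folklore] -/
theorem hsR_zero_left (Y : (Matrix n n ℂ)) : hsR 0 Y = 0 := by
  rw [hsR_comm]; exact hsR_zero_right Y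

/-- `hsR X (−Y) = − hsR X Y`. [folklore] -/
theorem hsR_neg_right (X Y : (Matrix n n ℂ)) : hsR X (-Y) = -hsR X Y := by
  have h := hsR_sub_right X 0 Y
  rw [zero_sub, hsR_zero_right] at h
  linarith

/-- Polarisation: `nhsNormSq (X + Y) = nhsNormSq X + nhsNormSq Y + 2·hsR X Y`. [folklore] -/
theorem nhsNormSq_add (X Y : (Matrix n n ℂ)) : nhsNormSq (X + Y) = nhsNormSq X + nhsNormSq Y + 2 * hsR X Y := by
  have h := nhsNormSq_sub X (-Y)
  rw [sub_neg_eq_add, nhsNormSq_neg, hsR_neg_right] at h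
  linarith

/-- `nhsNormSq X = 0 → X = 0` (through `opNorm_sq_le_card_mul_nhsNormSq`). [folklore] -/
theorem eq_zero_of_nhsNormSq_eq_zero {X : (Matrix n n ℂ)} (h : nhsNormSq X = 0) : X = 0 := by
  have h1 := opNorm_sq_le_card_mul_nhsNormSq X
  rw [h, mul_zero] at h1
  have h2 : ‖X‖ = 0 := by nlinarith [norm_nonneg X]
  exact norm_eq_zero.mp h2

/-! ## §2 Gauge directions are the orthogonal complement of the Landau directions -/

/-- Pointwise: `⟨Y(x,μ), gaugeDir W λ (x,μ)⟩ = ⟨Ad_{W(x,μ)} Y(x,μ), λ(x)⟩ − ⟨Y(x,μ), λ(x+e_μ)⟩` (unitary `W`). [folklore] -/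
theorem hsR_gaugeDir {W : Site d → Fin d → (Matrix n n ℂ)ˣ} (hWu : IsUnitaryCfg W) (Y : Site d → Fin d → (Matrix n n ℂ)) (lam : Site d → (Matrix n n ℂ))
    (x : Site d) (μ : Fin d) :
    hsR (Y x μ) (gaugeDir W lam x μ) = hsR (Ad (W x μ) (Y x μ)) (lam x) - hsR (Y x μ) (lam (x + e μ)) := by
  unfold gaugeDir
  rw [hsR_sub_right, ← hsR_Ad_left (hWu x μ)]

/-- **LANDAU ORTHOGONALITY**: for unitary `W` and `P`-periodic `Y`, `λ` (`P ≥ 1`),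
`Σ_{x∈periodBox P} Σ_μ hsR (Y x μ) (gaugeDir W λ x μ) = Σ_{x∈periodBox P} hsR (covDiv W Y x) (λ x)` — summation by parts on the
torus; no smallness, no curvature. [cite: Balaban1985Variational, (83) p.290] -/
theorem sum_hsR_gaugeDir {P : ℕ} (hP : 1 ≤ P) {W : Site d → Fin d → (Matrix n n ℂ)ˣ} (hWu : IsUnitaryCfg W) {Y : Site d → Fin d → (Matrix n n ℂ)}
    (hY : IsPeriodicDir Y (P : ℤ)) {lam : Site d → (Matrix n n ℂ)} (hlam : ∀ (x : Site d) (τ : Fin d), lam (x + (P : ℤ) • e τ) = lam x) :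
    ∑ x ∈ periodBox (d := d) P, ∑ μ : Fin d, hsR (Y x μ) (gaugeDir W lam x μ)
      = ∑ x ∈ periodBox (d := d) P, hsR (covDiv W Y x) (lam x) := by
  have h1 : ∀ x : Site d, ∑ μ : Fin d, hsR (Y x μ) (gaugeDir W lam x μ)
      = ∑ μ : Fin d, hsR (Ad (W x μ) (Y x μ)) (lam x) - ∑ μ : Fin d, hsR (Y x μ) (lam (x + e μ)) := by
    intro x
    rw [← Finset.sum_sub_distrib]
    exact Finset.sum_congr rfl fun μ _ => hsR_gaugeDir hWu Y lam x μ
  rw [Finset.sum_congr rfl fun x _ => h1 x, Finset.sum_sub_distrib]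
  -- the shifted term: `Σ_x Σ_μ ⟨Y(x,μ), λ(x+e_μ)⟩ = Σ_x Σ_μ ⟨Y(x−e_μ,μ), λ(x)⟩`
  have h2 : ∑ x ∈ periodBox (d := d) P, ∑ μ : Fin d, hsR (Y x μ) (lam (x + e μ))
      = ∑ x ∈ periodBox (d := d) P, ∑ μ : Fin d, hsR (Y (x - e μ) μ) (lam x) := by
    rw [Finset.sum_comm, Finset.sum_comm (s := periodBox (d := d) P)]
    refine Finset.sum_congr rfl fun μ _ => ?_
    set g : Site d → ℝ := fun y => hsR (Y (y - e μ) μ) (lam y) with hg_def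
    have hg : ∀ (x : Site d) (τ : Fin d), g (x + (P : ℤ) • e τ) = g x := by
      intro x τ
      simp only [hg_def]
      rw [show x + (P : ℤ) • e τ - e μ = (x - e μ) + (P : ℤ) • e τ by abel, hY, hlam]
    have h := sum_periodBox_shift P hP hg (e μ)
    simp only [hg_def, add_sub_cancel_right] at h
    simpa [hg_def] using h
  rw [h2, ← Finset.sum_sub_distrib]
  refine Finset.sum_congr rfl fun x _ => ?_
  rw [← Finset.sum_sub_distrib, covDiv, hsR_sum_left]
  exact Finset.sum_congr rfl fun μ _ => (hsR_sub_left _ _ _).symm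

/-- **PYTHAGORAS ON THE ORBIT OF A LANDAU DIRECTION**: `covDiv W Y = 0` on the period box ⇒
`Σ nhsNormSq (Y + gaugeDir W λ) = Σ nhsNormSq Y + Σ nhsNormSq (gaugeDir W λ)`. [folklore] -/
theorem sum_nhsNormSq_add_gaugeDir {P : ℕ} (hP : 1 ≤ P) {W : Site d → Fin d → (Matrix n n ℂ)ˣ} (hWu : IsUnitaryCfg W)
    {Y : Site d → Fin d → (Matrix n n ℂ)} (hY : IsPeriodicDir Y (P : ℤ)) {lam : Site d → (Matrix n n ℂ)}
    (hlam : ∀ (x : Site d) (τ : Fin d), lam (x + (P : ℤ) • e τ) = lam x)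
    (hdiv : ∀ x ∈ periodBox (d := d) P, covDiv W Y x = 0) :
    ∑ x ∈ periodBox (d := d) P, ∑ μ : Fin d, nhsNormSq (Y x μ + gaugeDir W lam x μ)
      = ∑ x ∈ periodBox (d := d) P, ∑ μ : Fin d, nhsNormSq (Y x μ)
        + ∑ x ∈ periodBox (d := d) P, ∑ μ : Fin d, nhsNormSq (gaugeDir W lam x μ) := by
  have horth : ∑ x ∈ periodBox (d := d) P, ∑ μ : Fin d, hsR (Y x μ) (gaugeDir W lam x μ) = 0 := by
    rw [sum_hsR_gaugeDir hP hWu hY hlam]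
    exact Finset.sum_eq_zero fun x hx => by rw [hdiv x hx, hsR_zero_left]
  simp_rw [nhsNormSq_add, Finset.sum_add_distrib, ← Finset.mul_sum]
  rw [horth, mul_zero, add_zero]

/-- **THE LANDAU REPRESENTATIVE MINIMISES THE ℓ²-NORM IN ITS LINEARISED GAUGE ORBIT**: `covDiv W Y = 0` on the period box ⇒
`Σ_{x,μ} nhsNormSq (Y x μ) ≤ Σ_{x,μ} nhsNormSq (Y x μ + gaugeDir W λ x μ)` for every `P`-periodic generator `λ`.
[cite: Balaban1985Variational, (83) p.290] -/
theorem sum_nhsNormSq_le_of_covDiv_eq_zero {P : ℕ} (hP : 1 ≤ P) {W : Site d → Fin d → (Matrix n n ℂ)ˣ} (hWu : IsUnitaryCfg W)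
    {Y : Site d → Fin d → (Matrix n n ℂ)} (hY : IsPeriodicDir Y (P : ℤ)) {lam : Site d → (Matrix n n ℂ)}
    (hlam : ∀ (x : Site d) (τ : Fin d), lam (x + (P : ℤ) • e τ) = lam x)
    (hdiv : ∀ x ∈ periodBox (d := d) P, covDiv W Y x = 0) :
    ∑ x ∈ periodBox (d := d) P, ∑ μ : Fin d, nhsNormSq (Y x μ)
      ≤ ∑ x ∈ periodBox (d := d) P, ∑ μ : Fin d, nhsNormSq (Y x μ + gaugeDir W lam x μ) := by
  rw [sum_nhsNormSq_add_gaugeDir hP hWu hY hlam hdiv]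
  have h : 0 ≤ ∑ x ∈ periodBox (d := d) P, ∑ μ : Fin d, nhsNormSq (gaugeDir W lam x μ) :=
    Finset.sum_nonneg fun _ _ => Finset.sum_nonneg fun _ _ => nhsNormSq_nonneg _
  linarith

/-- The covariant divergence of periodic data is periodic. [folklore] -/
theorem covDiv_add_period {P : ℕ} {W : Site d → Fin d → (Matrix n n ℂ)ˣ} (hWP : IsPeriodicCfg W (P : ℤ)) {Y : Site d → Fin d → (Matrix n n ℂ)}
    (hY : IsPeriodicDir Y (P : ℤ)) (x : Site d) (τ : Fin d) : covDiv W Y (x + (P : ℤ) • e τ) = covDiv W Y x := by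
  unfold covDiv
  refine Finset.sum_congr rfl fun μ _ => ?_
  rw [hWP x τ μ, hY x τ μ, show x + (P : ℤ) • e τ - e μ = (x - e μ) + (P : ℤ) • e τ by abel, hY]

/-- **CONVERSELY**: a `P`-periodic direction at a unitary `P`-periodic background which is `hsR`-orthogonal to EVERY `P`-periodic
gauge direction is covariantly divergence-free on the period box. [folklore] -/
theorem covDiv_eq_zero_of_orthogonal {P : ℕ} (hP : 1 ≤ P) {W : Site d → Fin d → (Matrix n n ℂ)ˣ} (hWu : IsUnitaryCfg W)
    (hWP : IsPeriodicCfg W (P : ℤ)) {Y : Site d → Fin d → (Matrix n n ℂ)} (hY : IsPeriodicDir Y (P : ℤ))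
    (horth : ∀ lam : Site d → (Matrix n n ℂ), (∀ (x : Site d) (τ : Fin d), lam (x + (P : ℤ) • e τ) = lam x) →
      ∑ x ∈ periodBox (d := d) P, ∑ μ : Fin d, hsR (Y x μ) (gaugeDir W lam x μ) = 0) :
    ∀ x ∈ periodBox (d := d) P, covDiv W Y x = 0 := by
  have hper : ∀ (x : Site d) (τ : Fin d), covDiv W Y (x + (P : ℤ) • e τ) = covDiv W Y x := covDiv_add_period hWP hY
  have h := horth (covDiv W Y) hper
  rw [sum_hsR_gaugeDir hP hWu hY hper] at h
  simp_rw [hsR_self] at h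
  have hx := (Finset.sum_eq_zero_iff_of_nonneg fun x _ => nhsNormSq_nonneg (covDiv W Y x)).1 h
  exact fun x hx' => eq_zero_of_nhsNormSq_eq_zero (hx x hx')

/-! ## §3 The orbit and the k-fold average -/

/-- A gauge direction with a skew generator at a unitary background is skew. [folklore] -/
theorem gaugeDir_skew {W : Site d → Fin d → (Matrix n n ℂ)ˣ} (hWu : IsUnitaryCfg W) {mu : Site d → (Matrix n n ℂ)}
    (hmu : ∀ x, mu x ∈ skewAdjoint (Matrix n n ℂ)) : IsSkewDir (gaugeDir W mu) := by
  letI : CStarAlgebra (Matrix n n ℂ) := {}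
  intro x μ
  unfold gaugeDir
  exact (skewAdjoint (Matrix n n ℂ)).sub_mem (Ad_mem_skewAdjoint ((unitaryUnits (Matrix n n ℂ)).inv_mem (hWu x μ)) (hmu x))
    (hmu _)

/-- **THE k-FOLD COVARIANT DOUBLE-BAR AVERAGE OF A GAUGE DIRECTION IS A COARSE GAUGE DIRECTION**: in the multi-level small-field class
(hypotheses of `NE3TangentCovariantTower.dirIter_gaugeDir`), with `U = cavgIter L (j+1) W`,
`QbarIter L (j+1) W (gaugeDir W μ) = gaugeDir U (μ ∘ L^{j+1}•) − gaugeDir U (framePotW L (j+1) W (gaugeDir W μ))`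
(`dirIter_gaugeDir` read through the structure theorem `dirIter_eq_QbarIter_add_gaugeDir`). [cite: Balaban1985Averaging, (45) p.24] -/
theorem QbarIter_gaugeDir [Nonempty n] {L M : ℕ} [NeZero M] (hL : 1 ≤ L) (j : ℕ) {W : Site d → Fin d → (Matrix n n ℂ)ˣ} {x : ℝ}
    (hWu : IsUnitaryCfg W) (hWP : IsPeriodicCfg W ((tower L M (j + 1) : ℕ) : ℤ)) (hx : 0 ≤ x) (hs : LevelSmall d L j x)
    (hWx : SmallField W x) {mu : Site d → (Matrix n n ℂ)} (hmu : ∀ x, mu x ∈ skewAdjoint (Matrix n n ℂ))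
    (hmuP : ∀ (y : Site d) (i : Fin d), mu (y + ((tower L M (j + 1) : ℕ) : ℤ) • e i) = mu y) :
    QbarIter L (j + 1) W (gaugeDir W mu) = fun z κ =>
      gaugeDir (cavgIter L (j + 1) W) (fun y => mu (((L : ℤ) ^ (j + 1)) • y)) z κ
        - gaugeDir (cavgIter L (j + 1) W) (framePotW L (j + 1) W (gaugeDir W mu)) z κ := by
  have h1 := dirIter_eq_QbarIter_add_gaugeDir (M := M) hL j hWu hWP hx hs hWx (gaugeDir_skew hWu hmu)
    (isPeriodicDir_gaugeDir hWP hmuP)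
  have h2 := dirIter_gaugeDir (M := M) hL j hWu hWP hx hs hWx hmu hmuP
  rw [h2] at h1
  funext z κ
  have hz := congr_fun (congr_fun h1 z) κ
  rw [hz, add_sub_cancel_right]

end

end Summit.QuantumFields.BalabanUV.T4Continuum.NE3LandauOrbit
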